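import Literature.NumberTheory.Automorphic.Zelevinsky1980.InducedMaximalParabolicEndomorphisms
import Literature.NumberTheory.Automorphic.Zelevinsky1980.CharacterInductionDegenerate
import Literature.NumberTheory.Automorphic.InducedCharacterInvariantForm
import Literature.NumberTheory.Automorphic.ParabolicInductionProofs
import Literature.NumberTheory.Automorphic.GLnLocalUnimodular
import Literature.NumberTheory.Automorphic.GLnGelfandKazhdanInvolution
import Literature.NumberTheory.Automorphic.InvariantMeasureGLModUnipotentProofs
import Literature.NumberTheory.Automorphic.UniformizerSeparatesCharacters
import Literature.NumberTheory.Automorphic.GLnMaximalParabolicLocalModulus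
import HarnessLib

/-!
# Irreducibility of `(ν₀ ∘ det) × χ′` on `GL_N(F)` for unitary `ν₀, χ′` — the regular cases

Topic `NumberTheory/Automorphic/Zelevinsky1980`; theorems only (no definition, no named fact). Let `F`
be a non-archimedean local field, `P = Q_{N-1,1} = standardParabolicGL F (lastBlockLabel N)` the
maximal standard parabolic of `GL_N(F)`, `χ_L` a UNITARY character of its Levi
`G_{(N-1,1)} = GL_{N-1}(F) × GL₁(F)` with open kernel, and
`I = i(χ_L) = Ind_P^{GL_N}(χ_L ∘ proj ⊗ δ_P^{1/2})` the normalised induction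
(`Representation.parabolicIndGL F (lastBlockLabel N) (𝟙.twist χ_L)`).

* `twist_comp_leviProjection_apply_eq`, `norm_twist_comp_leviProjection_apply_one_sq`,
  `twist_comp_leviProjection_eq_one_of_mem_unipotentRadicalP` — the inducing character
  `σ' = χ_L ∘ proj ⊗ δ^{1/2}`: its values, `|σ'(p)|² = Δ_P(p)`, triviality on `U_P`;
* `isIrreducible_parabolicIndGL_lastBlockLabel_of_ne` — **`I` is irreducible as soon as the two
  `U_P`-exponents differ**, `q_F σ'(d₀(ϖ)) ≠ σ'(d(ϖ))` (`d(ϖ) = diag(1,…,1,ϖ)`, `d₀(ϖ) = diag(ϖ,1,…,1)`):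
  `End_{GL_N}(I) = ℂ` (`exists_intertwiningMap_eq_smul`, the Jacquet-module / Bruhat-filtration
  computation of `Zelevinsky1980/*`), every subrepresentation has an invariant complement by unitarity
  (`exists_isCompl_subrepresentation_smoothIndRep_of_norm_sq_eq`: the invariant inner product
  `∫_{K₀} conj f₁ f₂`, `GL_N = P K₀`, `GL_N(F)` unimodular), and `I ≠ 0` (a standard section
  `Φ_{K,1}` of the open cell); hence irreducible (`isIrreducible_of_forall_intertwiningMap_of_exists_isCompl`);
* `isIrreducible_parabolicIndGL_lastBlockLabel_of_three_le` — for `N ≥ 3` the exponents have distinct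
  absolute values `q_F^{1/2} ≠ q_F^{(N-1)/2}`, so `I` is irreducible for EVERY unitary `χ_L`;
* `isIrreducible_parabolicIndGL_detChar_of_three_le`, `isIrreducible_parabolicIndGL_detChar_two_of_ne` —
  the data of the named fact `parabolicIndGL_detChar_unitary_isIrreducible`
  (`χ_L = (ν₀ ∘ det) ⊠ χ′`, `maxParabolicLeviChar`): all `N ≥ 3`, and `N = 2` with `ν₀ ≠ χ′`
  (a uniformizer `ϖ` with `ν₀(ϖ) ≠ χ′(ϖ)` exists, `exists_isUniformizingElement_map_ne`).

The cases `N ≤ 1` are `parabolicIndGL_detChar_isIrreducible_of_le_one` (`CharacterInductionDegenerate`);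
the irregular case `N = 2`, `ν₀ = χ′` (`χ × χ`, equal exponents) needs a non-semisimplicity witness in the
Jacquet module (sibling file) — together they give the fact for all `N`.

## References

* A. V. Zelevinsky, *Induced representations of reductive p-adic groups II*, Ann. Sci. ÉNS 13 (1980),
  Thm. 4.2 and §3.2 Example, p. 181/184. [Zelevinsky1980]
* I. N. Bernstein, A. V. Zelevinsky, *Induced representations of reductive p-adic groups I*,
  Ann. Sci. ÉNS 10 (1977), Thm. 5.2, §7.1. [BernsteinZelevinskyASENS1977]
-/

noncomputable section

open MeasureTheory Measure Matrix Literature.LinearAlgebra.Matrix.DiagonalTorus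
open scoped NNReal

namespace Literature.NumberTheory.Automorphic.Zelevinsky1980

open ValuativeRel

universe u

variable {F : Type u} [Field F] [ValuativeRel F] [TopologicalSpace F] [IsNonarchimedeanLocalField F]

/-! ### The inducing character `σ' = χ_L ∘ proj ⊗ δ^{1/2}` of `Q_{N-1,1}` -/

section Datum

variable {N : ℕ} (χL : (Π a : Bool, GL {i : Fin N // lastBlockLabel N i = a} F) →* ℂˣ)
  [LocallyCompactSpace (standardParabolicGL F (lastBlockLabel N))]

/-- **Values of the inducing character**: `σ'(p) z = δ^{1/2}(p) · χ_L(proj p) · z`.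
[cite: Zelevinsky1980, §3.2 Example, p. 181] -/
theorem twist_comp_leviProjection_apply_eq (p : ↥(standardParabolicGL F (lastBlockLabel N))) (z : ℂ) :
    Representation.twist (((Representation.trivial ℂ _ ℂ).twist χL).comp (leviProjection F (lastBlockLabel N)))
        (rootDeltaChar (standardParabolicGL F (lastBlockLabel N))) p z =
      ((rootDeltaChar (standardParabolicGL F (lastBlockLabel N)) p : ℂˣ) : ℂ) *
        (((χL (leviProjection F (lastBlockLabel N) p) : ℂˣ) : ℂ) * z) := by
  simp

/-- **`|σ'(p)|² = Δ_P(p)`** for a unitary Levi character `χ_L` (`(δ^{1/2})² = Δ_P`, Mathlib's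
`modularCharacter` of `↥P`). [cite: Zelevinsky1980, §3.2 Example, p. 181] -/
theorem norm_twist_comp_leviProjection_apply_one_sq (hχu : ∀ m, ‖((χL m : ℂˣ) : ℂ)‖ = 1)
    (p : ↥(standardParabolicGL F (lastBlockLabel N))) :
    ‖Representation.twist (((Representation.trivial ℂ _ ℂ).twist χL).comp (leviProjection F (lastBlockLabel N)))
        (rootDeltaChar (standardParabolicGL F (lastBlockLabel N))) p 1‖ ^ 2 =
      ((modularCharacter p : ℝ≥0) : ℝ) := by
  rw [twist_comp_leviProjection_apply_eq, mul_one, norm_mul, hχu, mul_one, rootDeltaChar_apply,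
    Complex.norm_real, Real.norm_of_nonneg (NNReal.coe_nonneg _), ← NNReal.coe_pow, NNReal.sq_sqrt]

/-- **`|σ'(p)| = √Δ_P(p)`** for a unitary Levi character. [cite: Zelevinsky1980, §3.2 Example, p. 181] -/
theorem norm_twist_comp_leviProjection_apply_one (hχu : ∀ m, ‖((χL m : ℂˣ) : ℂ)‖ = 1)
    (p : ↥(standardParabolicGL F (lastBlockLabel N))) :
    ‖Representation.twist (((Representation.trivial ℂ _ ℂ).twist χL).comp (leviProjection F (lastBlockLabel N)))
        (rootDeltaChar (standardParabolicGL F (lastBlockLabel N))) p 1‖ =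
      ((NNReal.sqrt (modularCharacter p) : ℝ≥0) : ℝ) := by
  rw [twist_comp_leviProjection_apply_eq, mul_one, norm_mul, hχu, mul_one, rootDeltaChar_apply,
    Complex.norm_real, Real.norm_of_nonneg (NNReal.coe_nonneg _)]

/-- **`σ'` is trivial on the unipotent radical `U_P`** (`δ^{1/2}` and `proj` are).
[cite: Zelevinsky1980, §1.1, p. 170] -/
theorem twist_comp_leviProjection_eq_one_of_mem_unipotentRadicalP
    (u : ↥(standardParabolicGL F (lastBlockLabel N))) (hu : u ∈ unipotentRadicalP F (lastBlockLabel N)) :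
    Representation.twist (((Representation.trivial ℂ _ ℂ).twist χL).comp (leviProjection F (lastBlockLabel N)))
        (rootDeltaChar (standardParabolicGL F (lastBlockLabel N))) u = 1 := by
  refine LinearMap.ext fun z => ?_
  rw [twist_comp_leviProjection_apply_eq, rootDeltaChar_eq_one_of_mem_unipotentRadicalP F (lastBlockLabel N) hu,
    MonoidHom.mem_ker.1 hu, map_one, Units.val_one, one_mul, one_mul, Module.End.one_apply]

end Datum

/-! ### The regular case: distinct exponents ⇒ irreducible -/

section Regular

variable {n : ℕ} (χL : (Π a : Bool, GL {i : Fin (n + 2) // lastBlockLabel (n + 2) i = a} F) →* ℂˣ)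
  [LocallyCompactSpace (standardParabolicGL F (lastBlockLabel (n + 2)))]

omit [LocallyCompactSpace (standardParabolicGL F (lastBlockLabel (n + 2)))] in
/-- **`i(χ_L) ≠ 0`**: the standard section `Φ_{K,1}` of the open cell takes the value `1` at `w₀`.
[cite: BernsteinZelevinskyASENS1977, Thm. 5.2 and §7.1] -/
theorem nontrivial_smoothInd_lastBlockLabel
    (σ' : Representation ℂ ↥(standardParabolicGL F (lastBlockLabel (n + 2))) ℂ) (hσ' : σ'.IsSmooth) :
    Nontrivial (Representation.SmoothInd (standardParabolicGL F (lastBlockLabel (n + 2))) σ') := by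
  classical
  obtain ⟨ϖ, hϖ⟩ := exists_isUniformizingElement (F := F)
  have hv0 : valuation F ϖ ≠ 0 := (Valuation.ne_zero_iff _).2 hϖ.ne_zero
  set K : Subgroup ↥(oppositeCellRadical (K := F) (lastBlockLabel (n + 2))) :=
    (congruenceGL (n + 2) (valuation F ϖ)).comap (oppositeCellRadical (K := F) (lastBlockLabel (n + 2))).subtype
    with hK
  set Φ := cellSection σ' (monotone_lastBlockLabel (n + 2)) hσ' K (isOpen_comap_congruenceGL hv0)
    (isCompact_comap_congruenceGL _) (1 : ℂ) with hΦ
  have h1 : σ' ⟨1, Subgroup.one_mem _⟩ = 1 := map_one σ'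
  have hval : Φ.toFun (1 * permGL Fin.revPerm * 1) = 1 := by
    rw [hΦ, toFun_cellSection, cellSectionFun_eq_of_mem (monotone_lastBlockLabel (n + 2)) (1 : ℂ)
      (Subgroup.one_mem _) (Subgroup.one_mem _) (by exact K.one_mem), h1, Module.End.one_apply]
  refine nontrivial_of_ne Φ 0 fun h => ?_
  have := congrArg (fun f : Representation.SmoothInd (standardParabolicGL F (lastBlockLabel (n + 2))) σ' =>
    f.toFun (1 * permGL Fin.revPerm * 1)) h
  simp only [hval, Representation.SmoothInd.toFun_zero, Pi.zero_apply, one_ne_zero] at this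

/-- **Distinct exponents ⇒ irreducible.** For a unitary admissible Levi character `χ_L` of
`G_{(N-1,1)}`, `N = n + 2 ≥ 2`, and a uniformizer `ϖ` with `q_F · σ'(d₀(ϖ)) ≠ σ'(d(ϖ))`
(`σ' = χ_L ∘ proj ⊗ δ^{1/2}`), the induced representation `i(χ_L)` of `GL_N(F)` is irreducible:
`End = ℂ` by the Jacquet-module computation and complete reducibility by unitarity.
[cite: Zelevinsky1980, Thm. 4.2 (2)⇒(1), p. 184] -/
theorem isIrreducible_parabolicIndGL_lastBlockLabel_of_ne (hχu : ∀ m, ‖((χL m : ℂˣ) : ℂ)‖ = 1)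
    (hχa : ((Representation.trivial ℂ _ ℂ).twist χL).IsAdmissible)
    {ϖ : F} (hϖ : IsUniformizingElement ϖ)
    (hne : (GaloisRepresentations.IsNonarchimedeanLocalField.residueFieldCard F : ℂ) *
        Representation.twist (((Representation.trivial ℂ _ ℂ).twist χL).comp (leviProjection F (lastBlockLabel (n + 2))))
          (rootDeltaChar (standardParabolicGL F (lastBlockLabel (n + 2))))
          ⟨diagGL (Fin (n + 2)) (Function.update 1 0 (Units.mk0 ϖ hϖ.ne_zero)), diagGL_mem_standardParabolicGL _ _⟩ 1 ≠
      Representation.twist (((Representation.trivial ℂ _ ℂ).twist χL).comp (leviProjection F (lastBlockLabel (n + 2))))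
          (rootDeltaChar (standardParabolicGL F (lastBlockLabel (n + 2))))
        ⟨diagGL (Fin (n + 2)) (Function.update 1 (Fin.last (n + 1)) (Units.mk0 ϖ hϖ.ne_zero)),
          diagGL_mem_standardParabolicGL _ _⟩ 1) :
    (Representation.parabolicIndGL F (lastBlockLabel (n + 2))
      ((Representation.trivial ℂ _ ℂ).twist χL)).IsIrreducible := by
  classical
  -- point-set and measure-theoretic instances on `GL_N(F)`
  haveI : T2Space (GL (Fin (n + 2)) F) := t2Space_generalLinearGroup F (n + 2)
  haveI : LocallyCompactSpace (GL (Fin (n + 2)) F) := locallyCompactSpace_generalLinearGroup F (n + 2)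
  haveI : SecondCountableTopology (GL (Fin (n + 2)) F) := secondCountableTopology_gl_localField F (n + 2)
  letI : MeasurableSpace (GL (Fin (n + 2)) F) := borel _
  haveI : BorelSpace (GL (Fin (n + 2)) F) := ⟨rfl⟩
  set μG : Measure (GL (Fin (n + 2)) F) := Measure.haar with hμG
  haveI : μG.IsMulRightInvariant := GLn.isMulRightInvariant_of_isHaarMeasure_local (n + 2) F μG
  -- the inducing character
  have hσ's : (Representation.twist (((Representation.trivial ℂ _ ℂ).twist χL).comp
      (leviProjection F (lastBlockLabel (n + 2)))) (rootDeltaChar (standardParabolicGL F (lastBlockLabel (n + 2))))).IsSmooth :=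
    Representation.IsSmooth.twist_comp_leviProjection (F := F) (c := lastBlockLabel (n + 2)) hχa.1
  have hadm : (Representation.parabolicIndGL F (lastBlockLabel (n + 2))
      ((Representation.trivial ℂ _ ℂ).twist χL)).IsAdmissible :=
    Representation.isAdmissible_parabolicIndGL_holds F (lastBlockLabel (n + 2)) _ hχa
  obtain ⟨K₀, hK₀c, hK₀o, hPK₀⟩ := exists_isCompact_isOpen_forall_standardParabolicGL_mul F (lastBlockLabel (n + 2))
  haveI := nontrivial_smoothInd_lastBlockLabel _ hσ's
  refine isIrreducible_of_forall_intertwiningMap_of_exists_isCompl _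
    (fun T => exists_intertwiningMap_eq_smul _ hσ's
      (twist_comp_leviProjection_eq_one_of_mem_unipotentRadicalP χL) hϖ hne T)
    (fun W => exists_isCompl_subrepresentation_smoothIndRep_of_norm_sq_eq _
      (isClosed_standardParabolicGL F (lastBlockLabel (n + 2))) hK₀o hK₀c hPK₀ μG
      (norm_twist_comp_leviProjection_apply_one_sq χL hχu) hadm W)

/-- **`N ≥ 3`: `i(χ_L)` is irreducible for every unitary admissible Levi character `χ_L`** of
`G_{(N-1,1)}`: the exponents have absolute values `q_F · q_F^{-1/2} = q_F^{1/2}` (open cell,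
`Δ_P(d₀(ϖ)) = q_F⁻¹`) and `q_F^{(N-1)/2}` (closed cell, `Δ_P(d(ϖ)) = q_F^{N-1}`), distinct as `q_F > 1`.
[cite: Zelevinsky1980, Thm. 4.2 (2)⇒(1), p. 184] -/
theorem isIrreducible_parabolicIndGL_lastBlockLabel_of_three_le {n : ℕ}
    (χL : (Π a : Bool, GL {i : Fin (n + 3) // lastBlockLabel (n + 3) i = a} F) →* ℂˣ)
    [LocallyCompactSpace (standardParabolicGL F (lastBlockLabel (n + 3)))]
    (hχu : ∀ m, ‖((χL m : ℂˣ) : ℂ)‖ = 1) (hχa : ((Representation.trivial ℂ _ ℂ).twist χL).IsAdmissible) :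
    (Representation.parabolicIndGL F (lastBlockLabel (n + 3))
      ((Representation.trivial ℂ _ ℂ).twist χL)).IsIrreducible := by
  classical
  obtain ⟨ϖ, hϖ⟩ := exists_isUniformizingElement (F := F)
  refine isIrreducible_parabolicIndGL_lastBlockLabel_of_ne (n := n + 1) χL hχu hχa hϖ fun h => ?_
  have h1 := congrArg (fun z : ℂ => ‖z‖ ^ 2) h
  simp only [norm_mul, mul_pow, Complex.norm_natCast] at h1
  rw [norm_twist_comp_leviProjection_apply_one_sq χL hχu, norm_twist_comp_leviProjection_apply_one_sq χL hχu,
    modularCharacter_diag_zero_uniformizer hϖ, modularCharacter_diag_last_uniformizer hϖ] at h1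
  -- `q² · q⁻¹ = q^{n+2}` is impossible for `q > 1`
  have hq : 1 < GaloisRepresentations.IsNonarchimedeanLocalField.residueFieldCard F :=
    GaloisRepresentations.IsNonarchimedeanLocalField.one_lt_residueFieldCard F
  set q := GaloisRepresentations.IsNonarchimedeanLocalField.residueFieldCard F with hqdef
  have hq0 : (q : ℝ) ≠ 0 := by exact_mod_cast (by omega : q ≠ 0)
  rw [NNReal.coe_inv, NNReal.coe_pow, NNReal.coe_natCast, sq, mul_assoc, mul_inv_cancel₀ hq0, mul_one] at h1
  have h2 : (q : ℝ) ^ 1 = (q : ℝ) ^ (n + 1 + 1) := by rw [pow_one]; exact h1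
  have h3 := pow_right_injective₀ (by positivity) (by exact_mod_cast hq.ne') h2
  omega

end Regular

/-! ### The Levi blocks of the diagonal elements `d₀(t) = diag(t,1,…,1)` and `d(t) = diag(1,…,1,t)` -/

section LeviBlocks

variable {n : ℕ}

omit [ValuativeRel F] [TopologicalSpace F] [IsNonarchimedeanLocalField F] in
/-- The `GL₁`-block of `d₀(t) = diag(t, 1, …, 1) ∈ Q_{N-1,1}` (`N ≥ 2`) is `1`.
[cite: Zelevinsky1980, §1.1, p. 170] -/
theorem det_leviProjection_diagGL_update_zero_true (t : Fˣ) :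
    Matrix.GeneralLinearGroup.det (leviProjection F (lastBlockLabel (n + 2))
      ⟨diagGL (Fin (n + 2)) (Function.update 1 0 t), diagGL_mem_standardParabolicGL _ _⟩ true) = 1 := by
  apply Units.ext
  rw [coe_det_leviProjection_lastBlockLabel_true (by omega), Subgroup.coe_mk, diagGL_apply_apply, if_pos rfl,
    Function.update_of_ne (fun h => by simp [Fin.ext_iff] at h), Pi.one_apply, Units.val_one]

omit [ValuativeRel F] [TopologicalSpace F] [IsNonarchimedeanLocalField F] in
/-- The `GL₁`-block of `d(t) = diag(1, …, 1, t) ∈ Q_{N-1,1}` is `t`. [cite: Zelevinsky1980, §1.1, p. 170] -/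
theorem det_leviProjection_diagGL_update_last_true (t : Fˣ) :
    Matrix.GeneralLinearGroup.det (leviProjection F (lastBlockLabel (n + 2))
      ⟨diagGL (Fin (n + 2)) (Function.update 1 (Fin.last (n + 1)) t), diagGL_mem_standardParabolicGL _ _⟩ true) = t := by
  apply Units.ext
  rw [coe_det_leviProjection_lastBlockLabel_true (by omega), Subgroup.coe_mk, diagGL_apply_apply, if_pos rfl,
    show (⟨n + 2 - 1, by omega⟩ : Fin (n + 2)) = Fin.last (n + 1) from Fin.ext (by simp),
    Function.update_self]

omit [ValuativeRel F] [TopologicalSpace F] [IsNonarchimedeanLocalField F] in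
/-- The `GL_{N-1}`-block of `d(t) = diag(1, …, 1, t) ∈ Q_{N-1,1}` is `1`. [cite: Zelevinsky1980, §1.1, p. 170] -/
theorem leviProjection_diagGL_update_last_false (t : Fˣ) :
    leviProjection F (lastBlockLabel (n + 2))
      ⟨diagGL (Fin (n + 2)) (Function.update 1 (Fin.last (n + 1)) t), diagGL_mem_standardParabolicGL _ _⟩ false = 1 := by
  apply Units.ext
  refine Matrix.ext fun i j => ?_
  rw [leviProjection_apply_coe, Subgroup.coe_mk, diagGL_apply_apply, Units.val_one, Matrix.one_apply]
  have hi : (i : Fin (n + 2)) ≠ Fin.last (n + 1) := by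
    intro h
    have := i.2
    rw [h, lastBlockLabel_apply, Fin.val_last, decide_eq_false_iff_not] at this
    omega
  by_cases hij : i = j
  · subst hij
    rw [if_pos rfl, if_pos rfl, Function.update_of_ne hi, Pi.one_apply, Units.val_one]
  · rw [if_neg (fun h => hij (Subtype.ext h)), if_neg hij]

omit [ValuativeRel F] [TopologicalSpace F] [IsNonarchimedeanLocalField F] in
/-- The `GL_{N-1}`-block of `d₀(t) = diag(t, 1, …, 1) ∈ Q_{N-1,1}` (`N ≥ 2`) has determinant `t`.
[cite: Zelevinsky1980, §1.1, p. 170] -/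
theorem det_leviProjection_diagGL_update_zero_false (t : Fˣ) :
    Matrix.GeneralLinearGroup.det (leviProjection F (lastBlockLabel (n + 2))
      ⟨diagGL (Fin (n + 2)) (Function.update 1 0 t), diagGL_mem_standardParabolicGL _ _⟩ false) = t := by
  classical
  apply Units.ext
  have h0 : lastBlockLabel (n + 2) 0 = false := by
    rw [lastBlockLabel_apply, decide_eq_false_iff_not, Fin.val_zero]; omega
  have hmat : ((leviProjection F (lastBlockLabel (n + 2))
      ⟨diagGL (Fin (n + 2)) (Function.update 1 0 t), diagGL_mem_standardParabolicGL _ _⟩ false :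
        GL {i : Fin (n + 2) // lastBlockLabel (n + 2) i = false} F) : Matrix _ _ F) =
      Matrix.diagonal fun i : {i : Fin (n + 2) // lastBlockLabel (n + 2) i = false} =>
        ((Function.update (1 : Fin (n + 2) → Fˣ) 0 t i.1 : Fˣ) : F) := by
    refine Matrix.ext fun i j => ?_
    rw [leviProjection_apply_coe, Subgroup.coe_mk, diagGL_apply_apply, Matrix.diagonal_apply]
    by_cases hij : i = j
    · subst hij; rw [if_pos rfl, if_pos rfl]
    · rw [if_neg (fun h => hij (Subtype.ext h)), if_neg hij]
  rw [Matrix.GeneralLinearGroup.val_det_apply, hmat, Matrix.det_diagonal,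
    Finset.prod_eq_single (⟨0, h0⟩ : {i : Fin (n + 2) // lastBlockLabel (n + 2) i = false})]
  · rw [Function.update_self]
  · intro i _ hi
    rw [Function.update_of_ne (fun h => hi (Subtype.ext h)), Pi.one_apply, Units.val_one]
  · intro h; exact absurd (Finset.mem_univ _) h

end LeviBlocks

/-! ### The data of the named fact: `χ_L = (ν₀ ∘ det) ⊠ χ′` -/

section DetChar

omit [ValuativeRel F] [TopologicalSpace F] [IsNonarchimedeanLocalField F] in
/-- The Levi character `(ν₀ ∘ det) ⊠ χ′` is unitary for unitary `ν₀, χ′`. [cite: Zelevinsky1980, §3.2 Example, p. 181] -/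
theorem norm_maxParabolicLeviChar (N : ℕ) (ν₀ χ' : Fˣ →* ℂˣ) (hν₀u : ∀ x, ‖((ν₀ x : ℂˣ) : ℂ)‖ = 1)
    (hχ'u : ∀ x, ‖((χ' x : ℂˣ) : ℂ)‖ = 1) (m : Π a : Bool, GL {i : Fin N // lastBlockLabel N i = a} F) :
    ‖((maxParabolicLeviChar F N ν₀ χ' m : ℂˣ) : ℂ)‖ = 1 := by
  rw [maxParabolicLeviChar_apply, Units.val_mul, norm_mul, hν₀u, hχ'u, mul_one]

/-- **[Zelevinsky1980, Thm. 4.2 (2)⇒(1)] for `(ν₀ ∘ det_{GL_{N-1}}) × χ′`, `N ≥ 3`, `ν₀, χ′` unitary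
continuous**: the normalised induction from `Q_{N-1,1}` is irreducible.
[cite: Zelevinsky1980, Thm. 4.2 (2)⇒(1), p. 184] -/
theorem isIrreducible_parabolicIndGL_detChar_of_three_le (N : ℕ) (hN : 3 ≤ N)
    [LocallyCompactSpace (standardParabolicGL F (lastBlockLabel N))]
    (ν₀ χ' : Fˣ →* ℂˣ) (hν₀u : ∀ x, ‖((ν₀ x : ℂˣ) : ℂ)‖ = 1) (hν₀c : Continuous fun x => ((ν₀ x : ℂˣ) : ℂ))
    (hχ'u : ∀ x, ‖((χ' x : ℂˣ) : ℂ)‖ = 1) (hχ'c : Continuous fun x => ((χ' x : ℂˣ) : ℂ)) :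
    (Representation.parabolicIndGL F (lastBlockLabel N)
      ((Representation.trivial ℂ (Π a : Bool, GL {i : Fin N // lastBlockLabel N i = a} F) ℂ).twist
        (maxParabolicLeviChar F N ν₀ χ'))).IsIrreducible := by
  obtain ⟨n, rfl⟩ : ∃ n, N = n + 3 := ⟨N - 3, by omega⟩
  exact isIrreducible_parabolicIndGL_lastBlockLabel_of_three_le (maxParabolicLeviChar F (n + 3) ν₀ χ')
    (norm_maxParabolicLeviChar (n + 3) ν₀ χ' hν₀u hχ'u)
    (Liu2021.SplitPlace.isAdmissible_trivial_twist _
      (Liu2021.SplitPlace.isOpen_ker_maxParabolicLeviChar (n + 3) ν₀ χ'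
        (Liu2021.SplitPlace.isOpen_ker_of_continuous ν₀ hν₀c)
        (Liu2021.SplitPlace.isOpen_ker_of_continuous χ' hχ'c)))

/-- **[Zelevinsky1980, Thm. 4.2 (2)⇒(1)] for `ν₀ × χ′` on `GL₂(F)`, `ν₀ ≠ χ′` unitary continuous**
(the regular rank-two case): for a uniformizer `ϖ` with `ν₀(ϖ) ≠ χ′(ϖ)`
(`exists_isUniformizingElement_map_ne`) the exponents `q^{1/2} ν₀(ϖ) ≠ q^{1/2} χ′(ϖ)` differ.
[cite: Zelevinsky1980, Thm. 4.2 (2)⇒(1), p. 184] -/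
theorem isIrreducible_parabolicIndGL_detChar_two_of_ne
    [LocallyCompactSpace (standardParabolicGL F (lastBlockLabel 2))]
    (ν₀ χ' : Fˣ →* ℂˣ) (hne : ν₀ ≠ χ') (hν₀u : ∀ x, ‖((ν₀ x : ℂˣ) : ℂ)‖ = 1)
    (hν₀c : Continuous fun x => ((ν₀ x : ℂˣ) : ℂ))
    (hχ'u : ∀ x, ‖((χ' x : ℂˣ) : ℂ)‖ = 1) (hχ'c : Continuous fun x => ((χ' x : ℂˣ) : ℂ)) :
    (Representation.parabolicIndGL F (lastBlockLabel 2)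
      ((Representation.trivial ℂ (Π a : Bool, GL {i : Fin 2 // lastBlockLabel 2 i = a} F) ℂ).twist
        (maxParabolicLeviChar F 2 ν₀ χ'))).IsIrreducible := by
  classical
  obtain ⟨ϖ, hϖ, hsep⟩ := exists_isUniformizingElement_map_ne hne
  refine isIrreducible_parabolicIndGL_lastBlockLabel_of_ne (n := 0) (maxParabolicLeviChar F 2 ν₀ χ')
    (norm_maxParabolicLeviChar 2 ν₀ χ' hν₀u hχ'u)
    (Liu2021.SplitPlace.isAdmissible_trivial_twist _
      (Liu2021.SplitPlace.isOpen_ker_maxParabolicLeviChar 2 ν₀ χ'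
        (Liu2021.SplitPlace.isOpen_ker_of_continuous ν₀ hν₀c)
        (Liu2021.SplitPlace.isOpen_ker_of_continuous χ' hχ'c))) hϖ fun h => hsep ?_
  rw [twist_comp_leviProjection_apply_eq, twist_comp_leviProjection_apply_eq, mul_one, mul_one,
    maxParabolicLeviChar_apply, maxParabolicLeviChar_apply,
    det_leviProjection_diagGL_update_zero_true, det_leviProjection_diagGL_update_zero_false,
    det_leviProjection_diagGL_update_last_true, leviProjection_diagGL_update_last_false, map_one, map_one,
    map_one, one_mul, mul_one, rootDeltaChar_apply, rootDeltaChar_apply,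
    modularCharacter_diag_zero_uniformizer hϖ, modularCharacter_diag_last_uniformizer hϖ, zero_add, pow_one,
    ← mul_assoc] at h
  -- `q · √(q⁻¹) = √q ≠ 0`
  have hq0 : (GaloisRepresentations.IsNonarchimedeanLocalField.residueFieldCard F : ℝ≥0) ≠ 0 := by
    exact_mod_cast (GaloisRepresentations.IsNonarchimedeanLocalField.one_lt_residueFieldCard F).ne_bot
  have hs : NNReal.sqrt (GaloisRepresentations.IsNonarchimedeanLocalField.residueFieldCard F : ℝ≥0) ≠ 0 :=
    fun h0 => hq0 (NNReal.sqrt_eq_zero.1 h0)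
  have hsqR : (GaloisRepresentations.IsNonarchimedeanLocalField.residueFieldCard F : ℝ≥0) *
      NNReal.sqrt ((GaloisRepresentations.IsNonarchimedeanLocalField.residueFieldCard F : ℝ≥0)⁻¹) =
      NNReal.sqrt (GaloisRepresentations.IsNonarchimedeanLocalField.residueFieldCard F : ℝ≥0) := by
    rw [NNReal.sqrt_inv, mul_inv_eq_iff_eq_mul₀ hs, NNReal.mul_self_sqrt]
  have hcast : (GaloisRepresentations.IsNonarchimedeanLocalField.residueFieldCard F : ℂ) =
      ((((GaloisRepresentations.IsNonarchimedeanLocalField.residueFieldCard F : ℝ≥0) : ℝ≥0) : ℝ) : ℂ) := by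
    norm_cast
  rw [hcast, ← Complex.ofReal_mul, ← NNReal.coe_mul, hsqR] at h
  have hs0 : (((NNReal.sqrt (GaloisRepresentations.IsNonarchimedeanLocalField.residueFieldCard F : ℝ≥0) : ℝ≥0) : ℝ) : ℂ) ≠ 0 := by
    rw [Ne, Complex.ofReal_eq_zero, NNReal.coe_eq_zero]
    exact hs
  exact Units.ext (mul_left_cancel₀ hs0 h)

end DetChar

end Literature.NumberTheory.Automorphic.Zelevinsky1980
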